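import Mathlib
import HarnessLib
import Literature.MathematicalPhysics.QuantumFieldTheory.WilsonFlow
import Summits.Ventures.LatticeQCDFlow.Exactness.SUNMultiStepLeapfrogHMCEngine
import Summits.Ventures.LatticeQCDFlow.Exactness.SUNResidualCouplingLayer

/-!
# The engine's `SU(N)` Wilson HMC force `(β/2)·P(Ω_e(U))` in the engine's coordinates: bounded and Lipschitz in the matrix sup norm, with constants that do not depend on the lattice size

HONEST FRAMING: exact (Metropolis-corrected) sampling algorithms for lattice gauge theory;
figures of merit are autocorrelation/cost numbers at stated couplings and volumes; no
continuum-physics claim.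

Venture `LatticeQCDFlow` (cell pub-lqcd), topic `Exactness`, FANOUT row 21 (`su3-base`: the 4-d `SU(3)`
baseline arm `E2 = PBC-HMC` runs the engine `latflow.core.hmc.HMC(f, β, 'leapfrog')`, whose momentum
update `_upd_P` subtracts `c · force(U)` with `force(U)_e = (β_eng/2N) · TA(U_e R_e(U))`, `gauge4d.force_ref`,
`sun.TA(M) = ½(M − M†) − tr(·)/N`, and `U_e R_e = Ω_e(U)` the sum of the plaquette loops through `e` starting
at `U_e`).  NEW WORK of the cell over the tree (`SUNMultiStepLeapfrogHMCEngine.lean`: the engine's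
`n`-step leapfrog HMC is uniformly ergodic for short trajectories for ANY measurable force field bounded by
`F_max` and `K_F`-Lipschitz in the matrix sup norm — listed there as NOT CLAIMED: "that the engine's force
routine `−½ε∂(βS_W)` is Lipschitz with a stated constant"; `SUNKickCoordinates.lean`, `SUNExpChart.lean`:
the coordinates `sunCoordι N` of `𝔰𝔲(N)` and their left inverse `coordOf`; `SUNProductTrajectory.lean`:
`coeConfig`, `‖U‖ ≤ N` on `SU(N)` in the `L∞` operator norm; `SUNResidualCouplingLayer.continuous_suProj`)
and the Literature Wilson flow (`QuantumFieldTheory/WilsonFlow.lean`: the projection `suProj = P = TA` and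
Lüscher's loop sum `plaquetteLoopSum V x μ = Ω_{x,μ}(V)`, used by name).  Nothing is cited as a fact; no
number.  Printed counterparts, NAMED ONLY: Lüscher, CMP 293 (2010) 899, App. A (`∂_{x,μ} S_w = P(Ω_{x,μ})`);
Gottlieb–Liu–Toussaint–Renken–Sugar, PRD 35 (1987) 2531 (the HMC force of the Wilson action).

## What is proved (`N ≥ 1`, every dimension `d`, EVERY torus size `L`, every real `β`)

* §1 `L∞`-operator-norm bookkeeping on `M_N(ℂ)`: an entry (in `ℝ≥0`), the conjugate transpose (`‖Aᴴ‖ ≤ N‖A‖`), the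
  trace (`‖tr A‖ ≤ N‖A‖`) and the projection (`norm_suProj_le_linfty`: `‖P(W)‖ ≤ (N+1)‖W‖`).
* §2 products of links: `‖↑(gh) − ↑(g'h')‖ ≤ N(‖↑g − ↑g'‖ + ‖↑h − ↑h'‖)`, `‖↑g⁻¹ − ↑g'⁻¹‖ ≤ N‖↑g − ↑g'‖`;
  hence (`norm_plaquetteLoopSum_le`, `norm_plaquetteLoopSum_sub_le`) `‖Ω_e(U)‖ ≤ 2dN` and
  `‖Ω_e(U) − Ω_e(U')‖ ≤ 10 d N⁵ · ‖U − U'‖_sup` — the loop sum reads `≤ 6(d−1)+1` links, so the constant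
  is LOCAL: it does not see `L`.
* §3 **`sunWilsonForce N β U e = (β/2) • coordOf (P(Ω_e(U)))`** — the force of the tree's action
  `β · wilsonAction (suRep N)` (`= β Σ_p (N − Re tr U_p)`; the engine's `β_eng Σ_p (1 − Re tr U_p/N)` with
  `β_eng = Nβ`, whose force matrix `(β_eng/2N)·TA(U_e R_e)` is the same matrix `(β/2)·P(Ω_e)`:
  `sunCoordι_sunWilsonForce`); `continuous_sunWilsonForce`, `measurable_sunWilsonForce`;
  **`norm_sunWilsonForce_le`** — `‖F_e(U)‖ ≤ sunWilsonForceSup N d β = |β|·κ_N·(N+1)·d·N`;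
  **`norm_sunWilsonForce_sub_le`** — `‖F(U) − F(U')‖_sup ≤ sunWilsonForceLip N d β · ‖U − U'‖_sup` with
  `sunWilsonForceLip N d β = 5|β|·κ_N·(N+1)·d·N⁵`, where `κ_N = sunCoordNorm N = ‖coordOf‖` is the operator
  norm of the coordinate map (a number depending on `N` only, not computed).  Both constants are
  INDEPENDENT OF THE LATTICE SIZE `L` — the input that makes the short-trajectory threshold of the
  HMC ergodicity theorem volume-independent (sequel `SUNWilsonHMCErgodic.lean`).

NOT CLAIMED: sharp constants (`2(d−1)` instead of `2d`, `√N` instead of `N`); the value of `κ_N`; that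
`(β/2)·P(Ω_e)` is the GRADIENT of `β S_W` for the trace form `−2 tr(XY)` (true for `L ≥ 2` by
`Scoring.WilsonStapleSum.wilsonAction_mulSingle_sub`; not needed: the kernel theorems cover any increment,
this file only certifies the engine's one); floating point.
-/

noncomputable section

namespace Summit.Ventures.LatticeQCDFlow.Exactness

open MeasureTheory Set Function
open Literature.MathematicalPhysics.QuantumFieldTheory
open scoped Matrix Matrix.Norms.Operator NNReal

set_option backward.isDefEq.respectTransparency false

/-! ## §1 `L∞` operator norm bookkeeping on `M_N(ℂ)` -/

section MatrixNorm

variable {m : Type*} [Fintype m]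

/-- An entry is bounded by the `L∞` operator norm (in `ℝ≥0`). -/
theorem nnnorm_entry_le_linfty_opNNNorm (A : Matrix m m ℂ) (i j : m) : ‖A i j‖₊ ≤ ‖A‖₊ := by
  rw [Matrix.linfty_opNNNorm_def]
  exact (Finset.single_le_sum (f := fun j => ‖A i j‖₊) (fun _ _ => by positivity) (Finset.mem_univ j)).trans
    (Finset.le_sup (f := fun i => ∑ j, ‖A i j‖₊) (Finset.mem_univ i))

/-- `‖Aᴴ‖ ≤ |m| · ‖A‖` in the `L∞` operator norm (row sums of `Aᴴ` are column sums of `A`). -/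
theorem linfty_opNorm_conjTranspose_le (A : Matrix m m ℂ) : ‖Aᴴ‖ ≤ Fintype.card m * ‖A‖ := by
  have h : ‖Aᴴ‖₊ ≤ Fintype.card m * ‖A‖₊ := by
    rw [Matrix.linfty_opNNNorm_def Aᴴ]
    refine Finset.sup_le fun i _ => ?_
    calc ∑ j, ‖Aᴴ i j‖₊ = ∑ j, ‖A j i‖₊ := by simp [Matrix.conjTranspose_apply]
      _ ≤ ∑ _j : m, ‖A‖₊ := Finset.sum_le_sum fun j _ => nnnorm_entry_le_linfty_opNNNorm A j i
      _ = Fintype.card m * ‖A‖₊ := by simp [Finset.sum_const, Finset.card_univ]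
  have h' := NNReal.coe_le_coe.2 h
  push_cast at h'
  exact h'

/-- `‖tr A‖ ≤ |m| · ‖A‖` in the `L∞` operator norm. -/
theorem norm_trace_le_linfty_opNorm (A : Matrix m m ℂ) : ‖A.trace‖ ≤ Fintype.card m * ‖A‖ := by
  have h : ‖A.trace‖₊ ≤ Fintype.card m * ‖A‖₊ := by
    calc ‖A.trace‖₊ = ‖∑ i, A i i‖₊ := by simp [Matrix.trace]
      _ ≤ ∑ i, ‖A i i‖₊ := nnnorm_sum_le _ _
      _ ≤ ∑ _i : m, ‖A‖₊ := Finset.sum_le_sum fun i _ => nnnorm_entry_le_linfty_opNNNorm A i i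
      _ = Fintype.card m * ‖A‖₊ := by simp [Finset.sum_const, Finset.card_univ]
  have h' := NNReal.coe_le_coe.2 h
  push_cast at h'
  exact h'

end MatrixNorm

section Proj

variable {N : ℕ} [NeZero N]

/-- **`‖P(W)‖ ≤ (N + 1)‖W‖`** for the projection `P = suProj` onto `𝔰𝔲(N)`, in the `L∞` operator norm. -/
theorem norm_suProj_le_linfty (W : Matrix (Fin N) (Fin N) ℂ) : ‖suProj W‖ ≤ (N + 1) * ‖W‖ := by
  have hN : (0 : ℝ) < N := by exact_mod_cast Nat.pos_of_ne_zero (NeZero.ne N)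
  have hW := norm_nonneg W
  have hT : ‖Wᴴ‖ ≤ N * ‖W‖ := by simpa using linfty_opNorm_conjTranspose_le W
  have h1 : ‖W - Wᴴ‖ ≤ (N + 1) * ‖W‖ := (norm_sub_le _ _).trans (by nlinarith)
  have htr0 : ‖(W - Wᴴ).trace‖ ≤ N * ‖W - Wᴴ‖ := by simpa using norm_trace_le_linfty_opNorm (W - Wᴴ)
  have htr : ‖(W - Wᴴ).trace‖ ≤ N * ((N + 1) * ‖W‖) := htr0.trans (mul_le_mul_of_nonneg_left h1 hN.le)
  have hc1 : ‖(1 / 2 : ℂ)‖ = 1 / 2 := by simp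
  have hc2 : ‖(1 / (2 * N) : ℂ)‖ = 1 / (2 * N) := by simp
  rw [suProj_def]
  calc ‖(1 / 2 : ℂ) • (W - Wᴴ) - ((1 / (2 * N) : ℂ) * (W - Wᴴ).trace) • (1 : Matrix (Fin N) (Fin N) ℂ)‖
      ≤ ‖(1 / 2 : ℂ) • (W - Wᴴ)‖ + ‖((1 / (2 * N) : ℂ) * (W - Wᴴ).trace) • (1 : Matrix (Fin N) (Fin N) ℂ)‖ :=
        norm_sub_le _ _
    _ = 1 / 2 * ‖W - Wᴴ‖ + 1 / (2 * N) * ‖(W - Wᴴ).trace‖ := by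
        rw [norm_smul, norm_smul, norm_one, mul_one, norm_mul, hc1, hc2]
    _ ≤ 1 / 2 * ((N + 1) * ‖W‖) + 1 / (2 * N) * (N * ((N + 1) * ‖W‖)) := by gcongr
    _ = (N + 1) * ‖W‖ := by field_simp; ring

end Proj

/-! ## §2 Products and inverses of links; the loop sum `Ω_e(U)` is bounded and Lipschitz, locally -/

section Links

variable {N : ℕ} {d L : ℕ}

/-- `‖↑g‖ ≤ N` for `g ∈ SU(N)` (`L∞` operator norm). -/
theorem norm_coe_su_le (g : Matrix.specialUnitaryGroup (Fin N) ℂ) : ‖(g : Matrix (Fin N) (Fin N) ℂ)‖ ≤ N := by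
  simpa using norm_le_card_of_mem_specialUnitaryGroup g.2

/-- Products: `‖↑(gh) − ↑(g'h')‖ ≤ N (‖↑g − ↑g'‖ + ‖↑h − ↑h'‖)`. -/
theorem norm_coe_mul_sub_le (g h g' h' : Matrix.specialUnitaryGroup (Fin N) ℂ) :
    ‖((g * h : Matrix.specialUnitaryGroup (Fin N) ℂ) : Matrix (Fin N) (Fin N) ℂ) - ↑(g' * h' : Matrix.specialUnitaryGroup (Fin N) ℂ)‖
      ≤ N * (‖(g : Matrix (Fin N) (Fin N) ℂ) - ↑g'‖ + ‖(h : Matrix (Fin N) (Fin N) ℂ) - ↑h'‖) := by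
  have e : ((g * h : Matrix.specialUnitaryGroup (Fin N) ℂ) : Matrix (Fin N) (Fin N) ℂ) - ↑(g' * h' : Matrix.specialUnitaryGroup (Fin N) ℂ)
      = ((g : Matrix (Fin N) (Fin N) ℂ) - ↑g') * (h : Matrix (Fin N) (Fin N) ℂ) + (g' : Matrix (Fin N) (Fin N) ℂ) * ((h : Matrix (Fin N) (Fin N) ℂ) - ↑h') := by
    simp only [Submonoid.coe_mul]
    noncomm_ring
  rw [e]
  calc ‖((g : Matrix (Fin N) (Fin N) ℂ) - ↑g') * (h : Matrix (Fin N) (Fin N) ℂ) + (g' : Matrix (Fin N) (Fin N) ℂ) * ((h : Matrix (Fin N) (Fin N) ℂ) - ↑h')‖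
      ≤ ‖(g : Matrix (Fin N) (Fin N) ℂ) - ↑g'‖ * ‖(h : Matrix (Fin N) (Fin N) ℂ)‖ + ‖(g' : Matrix (Fin N) (Fin N) ℂ)‖ * ‖(h : Matrix (Fin N) (Fin N) ℂ) - ↑h'‖ :=
        (norm_add_le _ _).trans (add_le_add (norm_mul_le _ _) (norm_mul_le _ _))
    _ ≤ ‖(g : Matrix (Fin N) (Fin N) ℂ) - ↑g'‖ * N + N * ‖(h : Matrix (Fin N) (Fin N) ℂ) - ↑h'‖ := by
        gcongr
        · exact norm_coe_su_le h
        · exact norm_coe_su_le g'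
    _ = N * (‖(g : Matrix (Fin N) (Fin N) ℂ) - ↑g'‖ + ‖(h : Matrix (Fin N) (Fin N) ℂ) - ↑h'‖) := by ring

/-- Inverses: `‖↑g⁻¹ − ↑g'⁻¹‖ ≤ N ‖↑g − ↑g'‖` (the inverse is the conjugate transpose). -/
theorem norm_coe_inv_sub_le (g g' : Matrix.specialUnitaryGroup (Fin N) ℂ) :
    ‖((g⁻¹ : Matrix.specialUnitaryGroup (Fin N) ℂ) : Matrix (Fin N) (Fin N) ℂ) - ↑(g'⁻¹ : Matrix.specialUnitaryGroup (Fin N) ℂ)‖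
      ≤ N * ‖(g : Matrix (Fin N) (Fin N) ℂ) - ↑g'‖ := by
  have h1 : ((g⁻¹ : Matrix.specialUnitaryGroup (Fin N) ℂ) : Matrix (Fin N) (Fin N) ℂ) - ↑(g'⁻¹ : Matrix.specialUnitaryGroup (Fin N) ℂ)
      = ((g : Matrix (Fin N) (Fin N) ℂ) - (g' : Matrix (Fin N) (Fin N) ℂ))ᴴ := by
    rw [Matrix.conjTranspose_sub]; rfl
  have h2 := linfty_opNorm_conjTranspose_le ((g : Matrix (Fin N) (Fin N) ℂ) - (g' : Matrix (Fin N) (Fin N) ℂ))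
  rw [Fintype.card_fin] at h2
  rw [h1]
  exact h2

/-- The plaquette pattern `a b c⁻¹ d⁻¹`: `‖Δ‖ ≤ 4N³ δ` when every link moves by at most `δ`. -/
theorem norm_coe_plaqWord_sub_le [NeZero N] {a b c e a' b' c' e' : Matrix.specialUnitaryGroup (Fin N) ℂ} {δ : ℝ}
    (ha : ‖(a : Matrix (Fin N) (Fin N) ℂ) - ↑a'‖ ≤ δ) (hb : ‖(b : Matrix (Fin N) (Fin N) ℂ) - ↑b'‖ ≤ δ)
    (hc : ‖(c : Matrix (Fin N) (Fin N) ℂ) - ↑c'‖ ≤ δ) (he : ‖(e : Matrix (Fin N) (Fin N) ℂ) - ↑e'‖ ≤ δ) :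
    ‖((a * b * c⁻¹ * e⁻¹ : Matrix.specialUnitaryGroup (Fin N) ℂ) : Matrix (Fin N) (Fin N) ℂ)
        - ↑(a' * b' * c'⁻¹ * e'⁻¹ : Matrix.specialUnitaryGroup (Fin N) ℂ)‖ ≤ 4 * N ^ 3 * δ := by
  have hN : (1 : ℝ) ≤ N := by exact_mod_cast Nat.one_le_iff_ne_zero.2 (NeZero.ne N)
  have hN0 : (0 : ℝ) ≤ N := by positivity
  have hδ : 0 ≤ δ := (norm_nonneg _).trans ha
  have h2 : ‖((a * b : Matrix.specialUnitaryGroup (Fin N) ℂ) : Matrix (Fin N) (Fin N) ℂ)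
      - ↑(a' * b' : Matrix.specialUnitaryGroup (Fin N) ℂ)‖ ≤ N * (δ + δ) :=
    (norm_coe_mul_sub_le a b a' b').trans (mul_le_mul_of_nonneg_left (add_le_add ha hb) hN0)
  have hc' : ‖((c⁻¹ : Matrix.specialUnitaryGroup (Fin N) ℂ) : Matrix (Fin N) (Fin N) ℂ)
      - ↑(c'⁻¹ : Matrix.specialUnitaryGroup (Fin N) ℂ)‖ ≤ N * δ :=
    (norm_coe_inv_sub_le c c').trans (mul_le_mul_of_nonneg_left hc hN0)
  have he' : ‖((e⁻¹ : Matrix.specialUnitaryGroup (Fin N) ℂ) : Matrix (Fin N) (Fin N) ℂ)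
      - ↑(e'⁻¹ : Matrix.specialUnitaryGroup (Fin N) ℂ)‖ ≤ N * δ :=
    (norm_coe_inv_sub_le e e').trans (mul_le_mul_of_nonneg_left he hN0)
  have h3 : ‖((a * b * c⁻¹ : Matrix.specialUnitaryGroup (Fin N) ℂ) : Matrix (Fin N) (Fin N) ℂ)
      - ↑(a' * b' * c'⁻¹ : Matrix.specialUnitaryGroup (Fin N) ℂ)‖ ≤ N * (N * (δ + δ) + N * δ) :=
    (norm_coe_mul_sub_le (a * b) c⁻¹ (a' * b') c'⁻¹).trans (mul_le_mul_of_nonneg_left (add_le_add h2 hc') hN0)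
  have h4 : ‖((a * b * c⁻¹ * e⁻¹ : Matrix.specialUnitaryGroup (Fin N) ℂ) : Matrix (Fin N) (Fin N) ℂ)
      - ↑(a' * b' * c'⁻¹ * e'⁻¹ : Matrix.specialUnitaryGroup (Fin N) ℂ)‖ ≤ N * (N * (N * (δ + δ) + N * δ) + N * δ) :=
    (norm_coe_mul_sub_le (a * b * c⁻¹) e⁻¹ (a' * b' * c'⁻¹) e'⁻¹).trans
      (mul_le_mul_of_nonneg_left (add_le_add h3 he') hN0)
  refine h4.trans ?_
  have : (N : ℝ) ^ 2 ≤ N ^ 3 := pow_le_pow_right₀ hN (by norm_num)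
  nlinarith

/-- The conjugated-plaquette pattern `f⁻¹ P f`: `‖Δ‖ ≤ 6N⁵ δ` when `‖ΔP‖ ≤ 4N³δ` and `‖Δf‖ ≤ δ`. -/
theorem norm_coe_conjWord_sub_le [NeZero N] {f P f' P' : Matrix.specialUnitaryGroup (Fin N) ℂ} {δ : ℝ}
    (hf : ‖(f : Matrix (Fin N) (Fin N) ℂ) - ↑f'‖ ≤ δ) (hP : ‖(P : Matrix (Fin N) (Fin N) ℂ) - ↑P'‖ ≤ 4 * N ^ 3 * δ) :
    ‖((f⁻¹ * P * f : Matrix.specialUnitaryGroup (Fin N) ℂ) : Matrix (Fin N) (Fin N) ℂ)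
        - ↑(f'⁻¹ * P' * f' : Matrix.specialUnitaryGroup (Fin N) ℂ)‖ ≤ 6 * N ^ 5 * δ := by
  have hN : (1 : ℝ) ≤ N := by exact_mod_cast Nat.one_le_iff_ne_zero.2 (NeZero.ne N)
  have hN0 : (0 : ℝ) ≤ N := by positivity
  have hδ : 0 ≤ δ := (norm_nonneg _).trans hf
  have hf' : ‖((f⁻¹ : Matrix.specialUnitaryGroup (Fin N) ℂ) : Matrix (Fin N) (Fin N) ℂ)
      - ↑(f'⁻¹ : Matrix.specialUnitaryGroup (Fin N) ℂ)‖ ≤ N * δ :=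
    (norm_coe_inv_sub_le f f').trans (mul_le_mul_of_nonneg_left hf hN0)
  have h2 : ‖((f⁻¹ * P : Matrix.specialUnitaryGroup (Fin N) ℂ) : Matrix (Fin N) (Fin N) ℂ)
      - ↑(f'⁻¹ * P' : Matrix.specialUnitaryGroup (Fin N) ℂ)‖ ≤ N * (N * δ + 4 * N ^ 3 * δ) :=
    (norm_coe_mul_sub_le f⁻¹ P f'⁻¹ P').trans (mul_le_mul_of_nonneg_left (add_le_add hf' hP) hN0)
  have h3 : ‖((f⁻¹ * P * f : Matrix.specialUnitaryGroup (Fin N) ℂ) : Matrix (Fin N) (Fin N) ℂ)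
      - ↑(f'⁻¹ * P' * f' : Matrix.specialUnitaryGroup (Fin N) ℂ)‖ ≤ N * (N * (N * δ + 4 * N ^ 3 * δ) + δ) :=
    (norm_coe_mul_sub_le (f⁻¹ * P) f (f'⁻¹ * P') f').trans (mul_le_mul_of_nonneg_left (add_le_add h2 hf) hN0)
  refine h3.trans ?_
  have h1 : (N : ℝ) ≤ N ^ 5 := le_self_pow₀ hN (by norm_num)
  have h3' : (N : ℝ) ^ 3 ≤ N ^ 5 := pow_le_pow_right₀ hN (by norm_num)
  nlinarith

/-- A link moves by at most the sup distance of the configurations. -/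
theorem norm_coe_link_sub_le [NeZero L] (U U' : GaugeConfig d L (Matrix.specialUnitaryGroup (Fin N) ℂ)) (e : Edge d L) :
    ‖((U e : Matrix.specialUnitaryGroup (Fin N) ℂ) : Matrix (Fin N) (Fin N) ℂ) - ↑(U' e : Matrix.specialUnitaryGroup (Fin N) ℂ)‖
      ≤ ‖coeConfig U - coeConfig U'‖ :=
  norm_le_pi_norm (coeConfig U - coeConfig U') e

/-- **`‖Ω_e(U)‖ ≤ 2dN`**: the loop sum is a sum of at most `2d` special unitary matrices. -/
theorem norm_plaquetteLoopSum_le (U : GaugeConfig d L (Matrix.specialUnitaryGroup (Fin N) ℂ)) (x : Site d L) (μ : Fin d) :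
    ‖plaquetteLoopSum U x μ‖ ≤ 2 * d * N := by
  unfold plaquetteLoopSum
  refine (norm_sum_le _ _).trans ?_
  calc ∑ ν : Fin d, ‖if ν = μ then (0 : Matrix (Fin N) (Fin N) ℂ) else
          (((plaquetteHolonomy U x μ ν : Matrix.specialUnitaryGroup (Fin N) ℂ) : Matrix (Fin N) (Fin N) ℂ) +
            (((U (x - Pi.single ν 1, ν))⁻¹ * plaquetteHolonomy U (x - Pi.single ν 1) ν μ * U (x - Pi.single ν 1, ν) :
              Matrix.specialUnitaryGroup (Fin N) ℂ) : Matrix (Fin N) (Fin N) ℂ))‖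
      ≤ ∑ _ν : Fin d, ((N : ℝ) + N) := Finset.sum_le_sum fun ν _ => by
        split_ifs
        · simp
        · exact (norm_add_le _ _).trans (add_le_add (norm_coe_su_le _) (norm_coe_su_le _))
    _ = 2 * d * N := by simp [Finset.sum_const, Finset.card_univ]; ring

/-- **`‖Ω_e(U) − Ω_e(U')‖ ≤ 10 d N⁵ · ‖U − U'‖_sup`** — the loop sum is Lipschitz with a LOCAL constant
(independent of the lattice size). -/
theorem norm_plaquetteLoopSum_sub_le [NeZero N] [NeZero L] (U U' : GaugeConfig d L (Matrix.specialUnitaryGroup (Fin N) ℂ))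
    (x : Site d L) (μ : Fin d) :
    ‖plaquetteLoopSum U x μ - plaquetteLoopSum U' x μ‖ ≤ 10 * d * N ^ 5 * ‖coeConfig U - coeConfig U'‖ := by
  have hN : (1 : ℝ) ≤ N := by exact_mod_cast Nat.one_le_iff_ne_zero.2 (NeZero.ne N)
  have hδ0 : 0 ≤ ‖coeConfig U - coeConfig U'‖ := norm_nonneg _
  have hδ := norm_coe_link_sub_le U U'
  have hplaq : ∀ (y : Site d L) (i j : Fin d),
      ‖((plaquetteHolonomy U y i j : Matrix.specialUnitaryGroup (Fin N) ℂ) : Matrix (Fin N) (Fin N) ℂ)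
          - ↑(plaquetteHolonomy U' y i j : Matrix.specialUnitaryGroup (Fin N) ℂ)‖
        ≤ 4 * N ^ 3 * ‖coeConfig U - coeConfig U'‖ := fun y i j => by
    unfold plaquetteHolonomy
    exact norm_coe_plaqWord_sub_le (hδ _) (hδ _) (hδ _) (hδ _)
  unfold plaquetteLoopSum
  rw [← Finset.sum_sub_distrib]
  refine (norm_sum_le _ _).trans ?_
  calc ∑ ν : Fin d, ‖(if ν = μ then (0 : Matrix (Fin N) (Fin N) ℂ) else
          (((plaquetteHolonomy U x μ ν : Matrix.specialUnitaryGroup (Fin N) ℂ) : Matrix (Fin N) (Fin N) ℂ) +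
            (((U (x - Pi.single ν 1, ν))⁻¹ * plaquetteHolonomy U (x - Pi.single ν 1) ν μ * U (x - Pi.single ν 1, ν) :
              Matrix.specialUnitaryGroup (Fin N) ℂ) : Matrix (Fin N) (Fin N) ℂ))) -
        (if ν = μ then (0 : Matrix (Fin N) (Fin N) ℂ) else
          (((plaquetteHolonomy U' x μ ν : Matrix.specialUnitaryGroup (Fin N) ℂ) : Matrix (Fin N) (Fin N) ℂ) +
            (((U' (x - Pi.single ν 1, ν))⁻¹ * plaquetteHolonomy U' (x - Pi.single ν 1) ν μ * U' (x - Pi.single ν 1, ν) :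
              Matrix.specialUnitaryGroup (Fin N) ℂ) : Matrix (Fin N) (Fin N) ℂ)))‖
      ≤ ∑ _ν : Fin d, 10 * N ^ 5 * ‖coeConfig U - coeConfig U'‖ := Finset.sum_le_sum fun ν _ => by
        split_ifs
        · simp only [sub_zero, norm_zero]; positivity
        · have hA := hplaq x μ ν
          have hB := norm_coe_conjWord_sub_le (hδ (x - Pi.single ν 1, ν)) (hplaq (x - Pi.single ν 1) ν μ)
          have h35 : (N : ℝ) ^ 3 ≤ N ^ 5 := pow_le_pow_right₀ hN (by norm_num)
          calc _ ≤ ‖((plaquetteHolonomy U x μ ν : Matrix.specialUnitaryGroup (Fin N) ℂ) : Matrix (Fin N) (Fin N) ℂ)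
                      - ↑(plaquetteHolonomy U' x μ ν : Matrix.specialUnitaryGroup (Fin N) ℂ)‖ +
                  ‖(((U (x - Pi.single ν 1, ν))⁻¹ * plaquetteHolonomy U (x - Pi.single ν 1) ν μ * U (x - Pi.single ν 1, ν) :
                      Matrix.specialUnitaryGroup (Fin N) ℂ) : Matrix (Fin N) (Fin N) ℂ)
                    - ↑((U' (x - Pi.single ν 1, ν))⁻¹ * plaquetteHolonomy U' (x - Pi.single ν 1) ν μ * U' (x - Pi.single ν 1, ν) :
                      Matrix.specialUnitaryGroup (Fin N) ℂ)‖ := by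
                  rw [add_sub_add_comm]; exact norm_add_le _ _
            _ ≤ 4 * N ^ 3 * ‖coeConfig U - coeConfig U'‖ + 6 * N ^ 5 * ‖coeConfig U - coeConfig U'‖ := add_le_add hA hB
            _ ≤ 10 * N ^ 5 * ‖coeConfig U - coeConfig U'‖ := by nlinarith [mul_le_mul_of_nonneg_right h35 hδ0]
    _ = 10 * d * N ^ 5 * ‖coeConfig U - coeConfig U'‖ := by simp [Finset.sum_const, Finset.card_univ]; ring

/-- `U ↦ Ω_{x,μ}(U)` is continuous. -/
theorem continuous_plaquetteLoopSum (x : Site d L) (μ : Fin d) :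
    Continuous fun U : GaugeConfig d L (Matrix.specialUnitaryGroup (Fin N) ℂ) => plaquetteLoopSum U x μ := by
  unfold plaquetteLoopSum
  refine continuous_finsetSum _ fun ν _ => ?_
  by_cases h : ν = μ
  · simp only [h, if_true]; exact continuous_const
  · simp only [h, if_false]
    refine (continuous_subtype_val.comp
      (Literature.MathematicalPhysics.QuantumLattice.continuous_plaquetteHolonomy x μ ν)).add
      (continuous_subtype_val.comp ?_)
    exact (((continuous_apply _).inv).mul
      (Literature.MathematicalPhysics.QuantumLattice.continuous_plaquetteHolonomy _ ν μ)).mul (continuous_apply _)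

end Links

/-! ## §3 The engine's Wilson HMC force in the engine's coordinates -/

section Force

variable (N : ℕ) {d L : ℕ}

/-- `κ_N = ‖coordOf‖`: the operator norm (for the `L∞` operator norm on matrices and the sup norm of the
coordinate space) of the tree's left inverse of the engine's coordinates `sunCoordι N` of `𝔰𝔲(N)`. -/
def sunCoordNorm : ℝ := ‖LinearMap.toContinuousLinearMap (coordOf (sunCoordι N) (sunCoordι_injective N))‖

/-- `κ_N ≥ 0`. -/
theorem sunCoordNorm_nonneg : 0 ≤ sunCoordNorm N :=
  norm_nonneg (LinearMap.toContinuousLinearMap (coordOf (sunCoordι N) (sunCoordι_injective N)))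

/-- `‖coordOf M‖ ≤ κ_N ‖M‖`. -/
theorem norm_coordOf_le (M : Matrix (Fin N) (Fin N) ℂ) :
    ‖coordOf (sunCoordι N) (sunCoordι_injective N) M‖ ≤ sunCoordNorm N * ‖M‖ :=
  (LinearMap.toContinuousLinearMap (coordOf (sunCoordι N) (sunCoordι_injective N))).le_opNorm M

/-- The sup bound of the force, `|β| κ_N (N+1) d N` — independent of the lattice size. -/
def sunWilsonForceSup (d : ℕ) (β : ℝ) : ℝ := |β| * sunCoordNorm N * (N + 1) * d * N

/-- The Lipschitz constant of the force, `5 |β| κ_N (N+1) d N⁵` — independent of the lattice size. -/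
def sunWilsonForceLip (d : ℕ) (β : ℝ) : ℝ := 5 * |β| * sunCoordNorm N * (N + 1) * d * N ^ 5

/-- `0 ≤ sunWilsonForceSup`. -/
theorem sunWilsonForceSup_nonneg (d : ℕ) (β : ℝ) : 0 ≤ sunWilsonForceSup N d β := by
  unfold sunWilsonForceSup; have := sunCoordNorm_nonneg N; positivity

/-- `0 ≤ sunWilsonForceLip`. -/
theorem sunWilsonForceLip_nonneg (d : ℕ) (β : ℝ) : 0 ≤ sunWilsonForceLip N d β := by
  unfold sunWilsonForceLip; have := sunCoordNorm_nonneg N; positivity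

/-- **THE ENGINE'S WILSON HMC FORCE** in the engine's coordinates of `𝔰𝔲(N)`:
`F_e(U) = (β/2) · coordOf (P(Ω_e(U)))`, the coordinates of the matrix `(β/2)·P(Ω_e(U))` = the engine's
`(β_eng/2N)·TA(U_e R_e)` at `β_eng = Nβ` (the force of the tree's action `β · wilsonAction (suRep N)`). -/
def sunWilsonForce (β : ℝ) (U : GaugeConfig d L (Matrix.specialUnitaryGroup (Fin N) ℂ)) (e : Edge d L) : SUNCoords N :=
  (β / 2) • coordOf (sunCoordι N) (sunCoordι_injective N) (suProj (plaquetteLoopSum U e.1 e.2))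

/-- **Dictionary**: read back in the matrix algebra, the force IS the matrix `(β/2)·P(Ω_e(U))`. -/
theorem sunCoordι_sunWilsonForce (β : ℝ) (U : GaugeConfig d L (Matrix.specialUnitaryGroup (Fin N) ℂ)) (e : Edge d L) :
    sunCoordι N (sunWilsonForce N β U e) = (β / 2) • suProj (plaquetteLoopSum U e.1 e.2) := by
  obtain ⟨c, hc⟩ := LinearMap.mem_range.1 (sunCoordι_range N (suProj (plaquetteLoopSum U e.1 e.2))
    (conjTranspose_suProj _) (trace_suProj _))
  rw [sunWilsonForce, map_smul, ← hc, coordOf_apply]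

/-- The force is a continuous function of the configuration. -/
theorem continuous_sunWilsonForce (β : ℝ) :
    Continuous (sunWilsonForce N β : GaugeConfig d L (Matrix.specialUnitaryGroup (Fin N) ℂ) → Edge d L → SUNCoords N) := by
  refine continuous_pi fun e => ?_
  exact (((continuous_coordOf (sunCoordι N) (sunCoordι_injective N)).comp continuous_suProj).comp
    (continuous_plaquetteLoopSum e.1 e.2)).const_smul (β / 2)

/-- The force is measurable (the hypothesis `hF` of the kernel theorems). -/
theorem measurable_sunWilsonForce [NeZero L] (β : ℝ) :
    Measurable (sunWilsonForce N β : GaugeConfig d L (Matrix.specialUnitaryGroup (Fin N) ℂ) → Edge d L → SUNCoords N) :=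
  measurable_pi_lambda _ fun e => ((((continuous_coordOf (sunCoordι N) (sunCoordι_injective N)).comp
    continuous_suProj).comp (continuous_plaquetteLoopSum e.1 e.2)).const_smul (β / 2)).measurable

/-- **`‖F_e(U)‖ ≤ sunWilsonForceSup N d β`** for every configuration and link, on every torus. -/
theorem norm_sunWilsonForce_le [NeZero N] (β : ℝ) (U : GaugeConfig d L (Matrix.specialUnitaryGroup (Fin N) ℂ)) (e : Edge d L) :
    ‖sunWilsonForce N β U e‖ ≤ sunWilsonForceSup N d β := by
  have hκ := sunCoordNorm_nonneg N
  have hN0 : (0 : ℝ) ≤ N := Nat.cast_nonneg N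
  have h1 : ‖coordOf (sunCoordι N) (sunCoordι_injective N) (suProj (plaquetteLoopSum U e.1 e.2))‖
      ≤ sunCoordNorm N * ((N + 1) * (2 * d * N)) :=
    (norm_coordOf_le N _).trans (mul_le_mul_of_nonneg_left
      ((norm_suProj_le_linfty _).trans (mul_le_mul_of_nonneg_left (norm_plaquetteLoopSum_le U e.1 e.2) (by positivity))) hκ)
  rw [sunWilsonForce, norm_smul, Real.norm_eq_abs, abs_div, abs_two, sunWilsonForceSup]
  calc |β| / 2 * ‖coordOf (sunCoordι N) (sunCoordι_injective N) (suProj (plaquetteLoopSum U e.1 e.2))‖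
      ≤ |β| / 2 * (sunCoordNorm N * ((N + 1) * (2 * d * N))) := mul_le_mul_of_nonneg_left h1 (by positivity)
    _ = |β| * sunCoordNorm N * (N + 1) * d * N := by ring

/-- **`‖F(U) − F(U')‖_sup ≤ sunWilsonForceLip N d β · ‖U − U'‖_sup`** (the hypothesis `hFK` of the kernel
theorems), on every torus, with a constant that does not depend on `L`. -/
theorem norm_sunWilsonForce_sub_le [NeZero N] [NeZero L] (β : ℝ) (U U' : GaugeConfig d L (Matrix.specialUnitaryGroup (Fin N) ℂ)) :
    ‖sunWilsonForce N β U - sunWilsonForce N β U'‖ ≤ sunWilsonForceLip N d β * ‖coeConfig U - coeConfig U'‖ := by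
  have hκ := sunCoordNorm_nonneg N
  have hN0 : (0 : ℝ) ≤ N := Nat.cast_nonneg N
  refine (pi_norm_le_iff_of_nonneg (mul_nonneg (sunWilsonForceLip_nonneg N d β) (norm_nonneg _))).2 fun e => ?_
  have hsub : (sunWilsonForce N β U - sunWilsonForce N β U') e =
      (β / 2) • coordOf (sunCoordι N) (sunCoordι_injective N)
        (suProj (plaquetteLoopSum U e.1 e.2 - plaquetteLoopSum U' e.1 e.2)) := by
    rw [Luscher2010.suProj_sub, map_sub, smul_sub]; rfl
  have h1 : ‖coordOf (sunCoordι N) (sunCoordι_injective N) (suProj (plaquetteLoopSum U e.1 e.2 - plaquetteLoopSum U' e.1 e.2))‖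
      ≤ sunCoordNorm N * ((N + 1) * (10 * d * N ^ 5 * ‖coeConfig U - coeConfig U'‖)) :=
    (norm_coordOf_le N _).trans (mul_le_mul_of_nonneg_left
      ((norm_suProj_le_linfty _).trans (mul_le_mul_of_nonneg_left (norm_plaquetteLoopSum_sub_le U U' e.1 e.2)
        (by positivity))) hκ)
  rw [hsub, norm_smul, Real.norm_eq_abs, abs_div, abs_two, sunWilsonForceLip]
  calc |β| / 2 * ‖coordOf (sunCoordι N) (sunCoordι_injective N) (suProj (plaquetteLoopSum U e.1 e.2 - plaquetteLoopSum U' e.1 e.2))‖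
      ≤ |β| / 2 * (sunCoordNorm N * ((N + 1) * (10 * d * N ^ 5 * ‖coeConfig U - coeConfig U'‖))) :=
        mul_le_mul_of_nonneg_left h1 (by positivity)
    _ = 5 * |β| * sunCoordNorm N * (N + 1) * d * N ^ 5 * ‖coeConfig U - coeConfig U'‖ := by ring

end Force

end Summit.Ventures.LatticeQCDFlow.Exactness
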